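import Summits.AtomisticToContinuum.Crystallization.Theses.ChessboardParticlePlanes
import Summits.AtomisticToContinuum.Crystallization.Theorems.ChessboardParticlePlanesLjPlaneChessboardPartnerLoad
import Summits.AtomisticToContinuum.Crystallization.Theorems.ChessboardParticlePlanesLjPlaneChessboardPartnerPhased
import Summits.AtomisticToContinuum.Crystallization.Theorems.ChessboardParticlePlanesLjPlaneChessboardPartnerCount

/-!
# Crux `ChessboardParticlePlanes.LjPlaneChessboard` (stmt-AtomisticToContinuum-6709), line `Sketch` —
# periodic (lattice-form) two-colour partner accounting

The certificate blocks of the crux are hard-core profiles `Ψ : ℝ → ℝ` (packing proxy: `0 ≤ Ψ 0`,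
`Ψ d ≤ Ψ 0` for `d < 1/3`, `Ψ d ≤ 0` for `1/3 ≤ d`, `Ψ d = 0` for `2/3 ≤ d`, `−Ψ0/6 ≤ Ψ d`)
coupling two layer motifs `F`, `G` of one planar lattice `L` with complex Bloch weights `α, β`.
Their LATTICE forms — the motif sums of the periodised profile `∑'_{v ∈ L} Ψ ‖x − y + v‖` — must
be non-negative for purely combinatorial reasons; this file is the periodic version of the landed
finite accounting `partnerAccountingPhased`:

* `finite_latticeShift_norm_lt` — a discrete lattice has finitely many points `v` with
  `‖z + v‖ < 2/3` (closed discrete subgroup ∩ bounded ball), hence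
  `summable_profile_latticeShift` — `v ↦ Ψ ‖z + v‖` is finitely supported, so summable;
* `sameColour_tsum_eq` — if `F + L` is `2/3`-separated, `Σ_{x,x' ∈ F} Σ'_v Ψ ‖x − x' + v‖ = |F| Ψ0`
  (only `x' = x`, `v = 0` contributes);
* `tsum_latticeShift_swap` — `Σ'_v f ‖y − x + v‖ = Σ'_v f ‖x − y + v‖` (substitute `v ↦ −v`);
* `load_bounds_family`, `periodicLoad_bounds` — for any point `x` and `G + L` `2/3`-separated,
  the periodic load `Σ_{y ∈ G} Σ'_v Ψ ‖x − y + v‖` is the load of `x` against the finite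
  `2/3`-separated planar set `{y − v}` of contributing points, so lies in `[−Ψ0, Ψ0]`
  (`partnerLoad_le`, `partnerLoad_ge` fed with `partnerCount_le_six`);
* `periodicTwoColour_nonneg` — the registered stub: with `m = min(|F|,|G|)` and `X` the cross sum,
  `|X| ≤ m Ψ0`, `|Re(conj α β)| ≤ ‖α‖ ‖β‖`, and
  `‖α‖²|F|Ψ0 + ‖β‖²|G|Ψ0 − 2 Re(conj α β) X ≥ m Ψ0 (‖α‖ − ‖β‖)² ≥ 0`.

[folklore; the "partner accounting" of the crux idea card `mismatch-field-certificate`, periodic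
form]
-/

noncomputable section

namespace Summit.AtomisticToContinuum.Crystallization.Theorems.ChessboardParticlePlanesLjPlaneChessboard

open Finset

section Lattice

variable (L : Submodule ℤ (EuclideanSpace ℝ (Fin 2))) [DiscreteTopology L]

/-- A discrete planar lattice has only finitely many points `v` with `‖z + v‖ < 2/3`: the lattice is
a closed discrete subset of the proper space `ℝ²`, so it meets the closed ball `B(−z, 2/3)` in a
finite set. [folklore] -/
theorem finite_latticeShift_norm_lt (z : EuclideanSpace ℝ (Fin 2)) :
    Set.Finite {v : L | ‖z + (v : EuclideanSpace ℝ (Fin 2))‖ < 2 / 3} := by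
  have hdisc : IsDiscrete (L : Set (EuclideanSpace ℝ (Fin 2))) :=
    SetLike.isDiscrete_iff_discreteTopology.2 ‹_›
  have hclosed : IsClosed (L : Set (EuclideanSpace ℝ (Fin 2))) := by
    haveI : DiscreteTopology L.toAddSubgroup := ‹DiscreteTopology L›
    rw [← Submodule.coe_toAddSubgroup]
    exact AddSubgroup.isClosed_of_discrete
  have hK : Set.Finite
      (Metric.closedBall (-z) (2 / 3) ∩ (L : Set (EuclideanSpace ℝ (Fin 2)))) :=
    Metric.finite_isBounded_inter_isClosed hdisc Metric.isBounded_closedBall hclosed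
  refine (hK.preimage Subtype.val_injective.injOn).subset fun v hv => ?_
  simp only [Set.mem_setOf_eq] at hv
  refine ⟨?_, v.2⟩
  rw [Metric.mem_closedBall, dist_eq_norm, sub_neg_eq_add, add_comm]
  exact hv.le

/-- If `Ψ` vanishes on `[2/3, ∞)`, the periodised family `v ↦ Ψ ‖z + v‖` over a discrete planar
lattice is finitely supported, hence summable. [folklore] -/
theorem summable_profile_latticeShift (Ψ : ℝ → ℝ) (hsupp : ∀ d : ℝ, (2 : ℝ) / 3 ≤ d → Ψ d = 0)
    (z : EuclideanSpace ℝ (Fin 2)) :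
    Summable (fun v : L => Ψ ‖z + (v : EuclideanSpace ℝ (Fin 2))‖) := by
  refine summable_of_ne_finset_zero (s := (finite_latticeShift_norm_lt L z).toFinset) ?_
  intro v hv
  rw [Set.Finite.mem_toFinset, Set.mem_setOf_eq, not_lt] at hv
  exact hsupp _ hv

omit [DiscreteTopology L] in
/-- **Same-colour periodic sums see only the diagonal.**  If `Ψ d = 0` for `2/3 ≤ d` and `F + L` is
`2/3`-separated (`‖x − x' + v‖ ≥ 2/3` unless `x = x'` and `v = 0`), then
`Σ_{x ∈ F} Σ_{x' ∈ F} Σ'_{v ∈ L} Ψ ‖x − x' + v‖ = |F| · Ψ 0`. [folklore] -/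
theorem sameColour_tsum_eq (Ψ : ℝ → ℝ) (hsupp : ∀ d : ℝ, (2 : ℝ) / 3 ≤ d → Ψ d = 0)
    (F : Finset (EuclideanSpace ℝ (Fin 2)))
    (hF : ∀ x ∈ F, ∀ x' ∈ F, ∀ v : L, (x ≠ x' ∨ v ≠ 0) →
      (2 : ℝ) / 3 ≤ ‖x - x' + (v : EuclideanSpace ℝ (Fin 2))‖) :
    ∑ x ∈ F, ∑ x' ∈ F, ∑' v : L, Ψ ‖x - x' + (v : EuclideanSpace ℝ (Fin 2))‖ = F.card * Ψ 0 := by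
  have hrow : ∀ x ∈ F,
      ∑ x' ∈ F, ∑' v : L, Ψ ‖x - x' + (v : EuclideanSpace ℝ (Fin 2))‖ = Ψ 0 := by
    intro x hx
    rw [Finset.sum_eq_single_of_mem x hx]
    · rw [tsum_eq_single (0 : L)]
      · rw [sub_self, zero_add, Submodule.coe_zero, norm_zero]
      · intro v hv
        exact hsupp _ (hF x hx x hx v (Or.inr hv))
    · intro x' hx' hne
      have h0 : ∀ v : L, Ψ ‖x - x' + (v : EuclideanSpace ℝ (Fin 2))‖ = 0 := fun v =>
        hsupp _ (hF x hx x' hx' v (Or.inl (Ne.symm hne)))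
      simp only [h0, tsum_zero]
  rw [Finset.sum_congr rfl hrow, Finset.sum_const, nsmul_eq_mul]

omit [DiscreteTopology L] in
/-- Substituting `v ↦ −v` in the lattice sum: `Σ'_v f ‖y − x + v‖ = Σ'_v f ‖x − y + v‖`.
[folklore] -/
theorem tsum_latticeShift_swap (f : ℝ → ℝ) (x y : EuclideanSpace ℝ (Fin 2)) :
    ∑' v : L, f ‖y - x + (v : EuclideanSpace ℝ (Fin 2))‖
      = ∑' v : L, f ‖x - y + (v : EuclideanSpace ℝ (Fin 2))‖ := by
  have h := tsum_comp_neg (fun v : L => f ‖x - y + (v : EuclideanSpace ℝ (Fin 2))‖)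
  rw [← h]
  refine tsum_congr fun v => ?_
  have e : x - y + -(v : EuclideanSpace ℝ (Fin 2)) = -(y - x + (v : EuclideanSpace ℝ (Fin 2))) := by
    abel
  simp only [Submodule.coe_neg, e, norm_neg]

omit [DiscreteTopology L] in
/-- **Load of a separated family.**  If `p : ι → ℝ²` is `2/3`-separated on a finite index set `s`
(hence injective there), the Ψ-load `Σ_{i ∈ s} Ψ(dist x (p i))` is the load of `x` against the
finite `2/3`-separated planar set `p(s)`, so it lies in `[−Ψ0, Ψ0]` by `partnerLoad_ge` (fed with
`partnerCount_le_six`) and `partnerLoad_le`. [folklore] -/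
theorem load_bounds_family {ι : Type*} (s : Finset ι) (p : ι → EuclideanSpace ℝ (Fin 2))
    (x : EuclideanSpace ℝ (Fin 2)) (Ψ : ℝ → ℝ) (hΨ0 : 0 ≤ Ψ 0)
    (hin : ∀ d : ℝ, d < 1 / 3 → Ψ d ≤ Ψ 0) (hout : ∀ d : ℝ, 1 / 3 ≤ d → Ψ d ≤ 0)
    (hsupp : ∀ d : ℝ, (2 : ℝ) / 3 ≤ d → Ψ d = 0) (hfloor : ∀ d : ℝ, -(Ψ 0) / 6 ≤ Ψ d)
    (hsep : ∀ i ∈ s, ∀ j ∈ s, i ≠ j → (2 : ℝ) / 3 ≤ dist (p i) (p j)) :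
    -(Ψ 0) ≤ ∑ i ∈ s, Ψ (dist x (p i)) ∧ ∑ i ∈ s, Ψ (dist x (p i)) ≤ Ψ 0 := by
  classical
  have hinj : Set.InjOn p s := by
    intro i hi j hj hij
    by_contra hne
    have h := hsep i hi j hj hne
    rw [hij, dist_self] at h
    norm_num at h
  have himg : ∑ t ∈ s.image p, Ψ (dist x t) = ∑ i ∈ s, Ψ (dist x (p i)) := Finset.sum_image hinj
  rw [← himg]
  have hsep' : ∀ t ∈ s.image p, ∀ t' ∈ s.image p, t ≠ t' → (2 : ℝ) / 3 ≤ dist t t' := by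
    intro t ht t' ht' hne
    obtain ⟨i, hi, rfl⟩ := Finset.mem_image.1 ht
    obtain ⟨j, hj, rfl⟩ := Finset.mem_image.1 ht'
    exact hsep i hi j hj fun hij => hne (by rw [hij])
  exact ⟨partnerLoad_ge partnerCount_le_six Ψ hΨ0 hsupp hfloor _ x hsep',
    partnerLoad_le Ψ hΨ0 hin hout _ x hsep'⟩

/-- **Periodic partner load.**  Let `G + L` be `2/3`-separated and `Ψ` a hard-core profile under
the packing proxy.  For every point `x`, the periodic load `Σ_{y ∈ G} Σ'_{v ∈ L} Ψ ‖x − y + v‖`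
lies in `[−Ψ0, Ψ0]`: only finitely many `(y, v)` contribute, the contributing points `y − v` are
pairwise `≥ 2/3` apart, and `‖x − y + v‖ = dist x (y − v)`, so this is a load of `x` against a
finite `2/3`-separated planar set (`load_bounds_family`). [folklore] -/
theorem periodicLoad_bounds (Ψ : ℝ → ℝ) (hΨ0 : 0 ≤ Ψ 0)
    (hin : ∀ d : ℝ, d < 1 / 3 → Ψ d ≤ Ψ 0) (hout : ∀ d : ℝ, 1 / 3 ≤ d → Ψ d ≤ 0)
    (hsupp : ∀ d : ℝ, (2 : ℝ) / 3 ≤ d → Ψ d = 0) (hfloor : ∀ d : ℝ, -(Ψ 0) / 6 ≤ Ψ d)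
    (G : Finset (EuclideanSpace ℝ (Fin 2)))
    (hG : ∀ y ∈ G, ∀ y' ∈ G, ∀ v : L, (y ≠ y' ∨ v ≠ 0) →
      (2 : ℝ) / 3 ≤ ‖y - y' + (v : EuclideanSpace ℝ (Fin 2))‖)
    (x : EuclideanSpace ℝ (Fin 2)) :
    -(Ψ 0) ≤ ∑ y ∈ G, ∑' v : L, Ψ ‖x - y + (v : EuclideanSpace ℝ (Fin 2))‖ ∧
      ∑ y ∈ G, ∑' v : L, Ψ ‖x - y + (v : EuclideanSpace ℝ (Fin 2))‖ ≤ Ψ 0 := by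
  classical
  -- a uniform finite set of lattice shifts carrying the support of every inner sum
  set S : Finset L := G.biUnion fun y => (finite_latticeShift_norm_lt L (x - y)).toFinset with hS
  have htsum : ∀ y ∈ G, ∑' v : L, Ψ ‖x - y + (v : EuclideanSpace ℝ (Fin 2))‖
      = ∑ v ∈ S, Ψ ‖x - y + (v : EuclideanSpace ℝ (Fin 2))‖ := by
    intro y hy
    refine tsum_eq_sum fun v hv => hsupp _ (not_lt.1 fun hlt => hv ?_)
    rw [hS, Finset.mem_biUnion]
    exact ⟨y, hy, by rw [Set.Finite.mem_toFinset]; exact hlt⟩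
  have hprod : ∑ y ∈ G, ∑ v ∈ S, Ψ ‖x - y + (v : EuclideanSpace ℝ (Fin 2))‖
      = ∑ q ∈ G ×ˢ S, Ψ (dist x (q.1 - (q.2 : EuclideanSpace ℝ (Fin 2)))) := by
    rw [Finset.sum_product]
    refine Finset.sum_congr rfl fun y _ => Finset.sum_congr rfl fun v _ => ?_
    rw [dist_eq_norm, sub_sub_eq_add_sub, add_sub_right_comm]
  rw [Finset.sum_congr rfl htsum, hprod]
  refine load_bounds_family (G ×ˢ S)
    (fun q : EuclideanSpace ℝ (Fin 2) × L => q.1 - (q.2 : EuclideanSpace ℝ (Fin 2))) x Ψ hΨ0 hin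
    hout hsupp hfloor ?_
  intro q hq q' hq' hne
  rw [Finset.mem_product] at hq hq'
  have hor : q.1 ≠ q'.1 ∨ (q'.2 - q.2 : L) ≠ 0 := by
    by_contra h
    rw [not_or, not_ne_iff, not_ne_iff, sub_eq_zero] at h
    exact hne (Prod.ext h.1 h.2.symm)
  have h23 := hG q.1 hq.1 q'.1 hq'.1 (q'.2 - q.2) hor
  have e : q.1 - (q.2 : EuclideanSpace ℝ (Fin 2)) - (q'.1 - (q'.2 : EuclideanSpace ℝ (Fin 2)))
      = q.1 - q'.1 + ((q'.2 - q.2 : L) : EuclideanSpace ℝ (Fin 2)) := by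
    rw [Submodule.coe_sub]; abel
  show (2 : ℝ) / 3 ≤ dist (q.1 - (q.2 : EuclideanSpace ℝ (Fin 2)))
    (q'.1 - (q'.2 : EuclideanSpace ℝ (Fin 2)))
  rw [dist_eq_norm, e]
  exact h23

end Lattice

/-- **Periodic (lattice-form) two-colour partner accounting (registered sub-goal of the crux).**
Let `L` be a planar lattice, `Ψ : ℝ → ℝ` a hard-core profile under the packing proxy (`0 ≤ Ψ 0`;
`Ψ d ≤ Ψ 0` for `d < 1/3`; `Ψ d ≤ 0` for `1/3 ≤ d`; `Ψ d = 0` for `2/3 ≤ d`; `−Ψ0/6 ≤ Ψ d`),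
`F`, `G` finite planar sets with `F + L` and `G + L` `2/3`-separated, and `α, β ∈ ℂ`.  Then
(i) every family `v ↦ Ψ ‖x − y + v‖` is summable over `L` (finitely supported), and
(ii) `0 ≤ ‖α‖² Σ_{x,x' ∈ F} Σ'_v Ψ ‖x − x' + v‖ + ‖β‖² Σ_{y,y' ∈ G} Σ'_v Ψ ‖y − y' + v‖
 − Re(conj α β) · (Σ_{x ∈ F, y ∈ G} Σ'_v Ψ ‖x − y + v‖ + Σ_{y ∈ G, x ∈ F} Σ'_v Ψ ‖y − x + v‖)`.
Proof: the same-colour sums are `|F| Ψ0`, `|G| Ψ0` (`sameColour_tsum_eq`); the two cross sums agree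
(`tsum_latticeShift_swap`, `Finset.sum_comm`) and the common value `X` satisfies `|X| ≤ |F| Ψ0`
(rows are periodic loads against `G + L`) and `|X| ≤ |G| Ψ0` (columns are periodic loads against
`F + L`), by `periodicLoad_bounds`; with `m = min(|F|,|G|)` and `|Re(conj α β)| ≤ ‖α‖ ‖β‖` the form
is `≥ (‖α‖²|F| + ‖β‖²|G| − 2‖α‖‖β‖ m) Ψ0 ≥ m Ψ0 (‖α‖ − ‖β‖)² ≥ 0`. [folklore] -/
theorem periodicTwoColour_nonneg :
    ∀ (L : Submodule ℤ (EuclideanSpace ℝ (Fin 2))) [DiscreteTopology L] [IsZLattice ℝ L]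
      (Ψ : ℝ → ℝ) (F G : Finset (EuclideanSpace ℝ (Fin 2))) (α β : ℂ),
      0 ≤ Ψ 0 → (∀ d : ℝ, d < 1 / 3 → Ψ d ≤ Ψ 0) → (∀ d : ℝ, 1 / 3 ≤ d → Ψ d ≤ 0) →
      (∀ d : ℝ, (2 : ℝ) / 3 ≤ d → Ψ d = 0) → (∀ d : ℝ, -(Ψ 0) / 6 ≤ Ψ d) →
      (∀ x ∈ F, ∀ x' ∈ F, ∀ v : L, (x ≠ x' ∨ v ≠ 0) →
        (2 : ℝ) / 3 ≤ ‖x - x' + (v : EuclideanSpace ℝ (Fin 2))‖) →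
      (∀ y ∈ G, ∀ y' ∈ G, ∀ v : L, (y ≠ y' ∨ v ≠ 0) →
        (2 : ℝ) / 3 ≤ ‖y - y' + (v : EuclideanSpace ℝ (Fin 2))‖) →
      (∀ (x y : EuclideanSpace ℝ (Fin 2)),
        Summable (fun v : L => Ψ ‖x - y + (v : EuclideanSpace ℝ (Fin 2))‖)) ∧
      0 ≤ ‖α‖ ^ 2 * (∑ x ∈ F, ∑ x' ∈ F, ∑' v : L, Ψ ‖x - x' + (v : EuclideanSpace ℝ (Fin 2))‖)
          + ‖β‖ ^ 2 * (∑ y ∈ G, ∑ y' ∈ G, ∑' v : L, Ψ ‖y - y' + (v : EuclideanSpace ℝ (Fin 2))‖)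
          - (starRingEnd ℂ α * β).re *
              ((∑ x ∈ F, ∑ y ∈ G, ∑' v : L, Ψ ‖x - y + (v : EuclideanSpace ℝ (Fin 2))‖)
               + (∑ y ∈ G, ∑ x ∈ F, ∑' v : L, Ψ ‖y - x + (v : EuclideanSpace ℝ (Fin 2))‖)) := by
  intro L _ _ Ψ F G α β hΨ0 hin hout hsupp hfloor hF hG
  refine ⟨fun x y => summable_profile_latticeShift L Ψ hsupp (x - y), ?_⟩
  have hrow := fun x => periodicLoad_bounds L Ψ hΨ0 hin hout hsupp hfloor G hG x
  have hcol := fun y => periodicLoad_bounds L Ψ hΨ0 hin hout hsupp hfloor F hF y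
  -- the two cross sums agree
  have hswap : ∑ y ∈ G, ∑ x ∈ F, ∑' v : L, Ψ ‖y - x + (v : EuclideanSpace ℝ (Fin 2))‖
      = ∑ x ∈ F, ∑ y ∈ G, ∑' v : L, Ψ ‖x - y + (v : EuclideanSpace ℝ (Fin 2))‖ := by
    rw [Finset.sum_comm]
    exact Finset.sum_congr rfl fun x _ => Finset.sum_congr rfl fun y _ =>
      tsum_latticeShift_swap L Ψ x y
  -- row bounds: |X| ≤ |F| Ψ0
  have hXF1 : -((F.card : ℝ) * Ψ 0)
      ≤ ∑ x ∈ F, ∑ y ∈ G, ∑' v : L, Ψ ‖x - y + (v : EuclideanSpace ℝ (Fin 2))‖ := by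
    calc -((F.card : ℝ) * Ψ 0) = ∑ _x ∈ F, -(Ψ 0) := by
          rw [Finset.sum_const, nsmul_eq_mul, mul_neg]
      _ ≤ _ := Finset.sum_le_sum fun x _ => (hrow x).1
  have hXF2 : ∑ x ∈ F, ∑ y ∈ G, ∑' v : L, Ψ ‖x - y + (v : EuclideanSpace ℝ (Fin 2))‖
      ≤ (F.card : ℝ) * Ψ 0 := by
    calc _ ≤ ∑ _x ∈ F, Ψ 0 := Finset.sum_le_sum fun x _ => (hrow x).2
      _ = (F.card : ℝ) * Ψ 0 := by rw [Finset.sum_const, nsmul_eq_mul]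
  -- column bounds: |X| ≤ |G| Ψ0
  have hXG1 : -((G.card : ℝ) * Ψ 0)
      ≤ ∑ y ∈ G, ∑ x ∈ F, ∑' v : L, Ψ ‖y - x + (v : EuclideanSpace ℝ (Fin 2))‖ := by
    calc -((G.card : ℝ) * Ψ 0) = ∑ _y ∈ G, -(Ψ 0) := by
          rw [Finset.sum_const, nsmul_eq_mul, mul_neg]
      _ ≤ _ := Finset.sum_le_sum fun y _ => (hcol y).1
  have hXG2 : ∑ y ∈ G, ∑ x ∈ F, ∑' v : L, Ψ ‖y - x + (v : EuclideanSpace ℝ (Fin 2))‖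
      ≤ (G.card : ℝ) * Ψ 0 := by
    calc _ ≤ ∑ _y ∈ G, Ψ 0 := Finset.sum_le_sum fun y _ => (hcol y).2
      _ = (G.card : ℝ) * Ψ 0 := by rw [Finset.sum_const, nsmul_eq_mul]
  rw [hswap] at hXG1 hXG2
  rw [sameColour_tsum_eq L Ψ hsupp F hF, sameColour_tsum_eq L Ψ hsupp G hG, hswap]
  set X := ∑ x ∈ F, ∑ y ∈ G, ∑' v : L, Ψ ‖x - y + (v : EuclideanSpace ℝ (Fin 2))‖ with hX
  -- finish: |X| ≤ m Ψ0, |Re(conj α β)| ≤ ‖α‖ ‖β‖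
  set m := min (F.card : ℝ) (G.card : ℝ) with hm
  have hmF : m ≤ (F.card : ℝ) := min_le_left _ _
  have hmG : m ≤ (G.card : ℝ) := min_le_right _ _
  have hm0 : 0 ≤ m := le_min (Nat.cast_nonneg _) (Nat.cast_nonneg _)
  have hXabs : |X| ≤ m * Ψ 0 := by
    rw [abs_le]
    rcases le_total (F.card : ℝ) (G.card : ℝ) with h | h
    · rw [hm, min_eq_left h]; exact ⟨by linarith, hXF2⟩
    · rw [hm, min_eq_right h]; exact ⟨by linarith, hXG2⟩
  set r := (starRingEnd ℂ α * β).re with hr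
  have hrabs : |r| ≤ ‖α‖ * ‖β‖ := by
    calc |r| ≤ ‖starRingEnd ℂ α * β‖ := Complex.abs_re_le_norm _
      _ = ‖α‖ * ‖β‖ := by rw [norm_mul, Complex.norm_conj]
  have hrX : r * (X + X) ≤ ‖α‖ * ‖β‖ * (2 * (m * Ψ 0)) := by
    calc r * (X + X) ≤ |r * (X + X)| := le_abs_self _
      _ = |r| * |X + X| := abs_mul r _
      _ ≤ ‖α‖ * ‖β‖ * (2 * (m * Ψ 0)) := by
          refine mul_le_mul hrabs ?_ (abs_nonneg _) (mul_nonneg (norm_nonneg _) (norm_nonneg _))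
          calc |X + X| ≤ |X| + |X| := abs_add_le X X
            _ ≤ 2 * (m * Ψ 0) := by linarith
  have hkey : ‖α‖ * ‖β‖ * (2 * (m * Ψ 0))
      ≤ ‖α‖ ^ 2 * ((F.card : ℝ) * Ψ 0) + ‖β‖ ^ 2 * ((G.card : ℝ) * Ψ 0) := by
    have e1 : ‖α‖ ^ 2 * (m * Ψ 0) ≤ ‖α‖ ^ 2 * ((F.card : ℝ) * Ψ 0) :=
      mul_le_mul_of_nonneg_left (mul_le_mul_of_nonneg_right hmF hΨ0) (sq_nonneg _)
    have e2 : ‖β‖ ^ 2 * (m * Ψ 0) ≤ ‖β‖ ^ 2 * ((G.card : ℝ) * Ψ 0) :=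
      mul_le_mul_of_nonneg_left (mul_le_mul_of_nonneg_right hmG hΨ0) (sq_nonneg _)
    have e3 : 0 ≤ (‖α‖ - ‖β‖) ^ 2 * (m * Ψ 0) := mul_nonneg (sq_nonneg _) (mul_nonneg hm0 hΨ0)
    nlinarith
  linarith

end Summit.AtomisticToContinuum.Crystallization.Theorems.ChessboardParticlePlanesLjPlaneChessboard

end
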